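import Mathlib.Analysis.Calculus.Deriv.Slope
import Mathlib.Analysis.Convex.Slope
import Mathlib.Topology.Order.Monotone
import Mathlib.Order.LiminfLimsup
import Mathlib.Topology.Algebra.Order.LiminfLimsup
import HarnessLib

/-!
# Sourced ground-state energies: the Hellmann–Feynman sandwich, Griffiths' lemma in the source,
# and the order-parameter CUSP identity `⨅_{h>0} liminf_L m_L(h) = -½ ∂⁺g(0)` (abstract core)

Topic `Literature/MathematicalPhysics/QuantumLattice` (sub-namespace `SourceSandwich` naming the object).
Model-free real analysis: the finite-volume input is the Hellmann–Feynman SANDWICH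
`(h′ − h)·2r(h) ≤ e(h) − e(h′)` (all real `h, h′`) between a sourced ground-state energy per site
`e(h) = E₀(K − hO)/|Λ|` and the response density `r(h) = ω_h(O)/(2|Λ|)` (tree:
`dWaveSourceDensity_mul_le_groundEnergy_drop`, `sub_mul_re_groundStateFunctional_le`); the `d`-wave Hubbard
instantiation (`dWaveOrderParameter U μ = ⨅_{h>0} liminf_L m_{L+1}(h)`) is `DWaveSourceEnergyDensityLimit.lean`.
Hubbard ladder, rung CQ, rows PC-a/PC-c. No definition, no named fact, no `sorry`.

## Contents

§1 ONE VOLUME. The sandwich gives the chord floor/ceiling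
`(e(h₁) − e(h))/(2(h − h₁)) ≤ r(h) ≤ (e(h) − e(h₂))/(2(h₂ − h))` (`h₁ < h < h₂`), `r` monotone, `e`
concave on `ℝ`, and `|e(h) − e(h′)| ≤ 2B|h − h′|` when `|r| ≤ B`.

§2 THERMODYNAMIC LIMIT. For sequences `E_L, m_L` with the sandwich at every `L`, `|m_L| ≤ B`, and
POINTWISE limits `E_L(h) → g(h)`:
* limit brackets `(g(h₁) − g(h))/(2(h − h₁)) ≤ liminf_L m_L(h)`, `limsup_L m_L(h) ≤ (g(h) − g(h₂))/(2(h₂ − h))`;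
* GRIFFITHS' LEMMA, one-sided: a LEFT derivative `g′₋(h)` gives `−g′₋(h)/2 ≤ liminf_L m_L(h)`, a RIGHT
  derivative gives `limsup_L m_L(h) ≤ −g′₊(h)/2`, a derivative gives `m_L(h) → −g′(h)/2`
  (Griffiths 1966 §II; the tree's two-sided sequence form is `tendsto_of_slope_sandwich` in
  `HubbardGrandCanonicalDensity.lean`, for the `μ`-direction);
* limits on `[0, ∞)`: `g` is concave and `2B`-Lipschitz on `[0,∞)`; the CUSP IDENTITY
  `⨅_{h>0} liminf_L m_L(h) = ⨅_{h>0} (g(0) − g(h))/(2h) = lim_{h→0⁺} (g(0) − g(h))/(2h)` (the secant is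
  non-decreasing in `h`), `= −g′₊(0)/2` when the right derivative exists, and
  `0 < ⨅_{h>0} liminf_L m_L(h) ↔ ∃ c > 0, ∀ h > 0, g(h) ≤ g(0) − 2ch` (order = LINEAR cusp).

Not here: existence of any limit `g` (always a hypothesis); window-fed finite-volume brackets.

## References

* R. B. Griffiths, *Spontaneous magnetization in idealized ferromagnets*, Phys. Rev. 152 (1966)
  240–246, §II (one-sided derivatives of a concave thermodynamic function bound the conjugate order
  parameter; limits of finite-volume derivatives). [cite: Griffiths1966, §II]
* T. Koma, H. Tasaki, *Symmetry breaking and finite-size effects in quantum many-body systems*,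
  J. Stat. Phys. 76 (1994) 745–803, §1 (order parameter `lim_{h↓0} lim_{Λ↑ℤ^d} |Λ|⁻¹ω(O_Λ)` from
  `H_Λ − hO_Λ`; the ground-state energy is concave in `h`). [cite: KomaTasaki1994, §1]
-/

noncomputable section

namespace Literature.MathematicalPhysics.QuantumLattice

open Filter Set
open scoped Topology

namespace SourceSandwich

/-! ### §1 One volume: the Hellmann–Feynman sandwich -/

section OneVolume

variable {e r : ℝ → ℝ} {B : ℝ}

/-- **Chord floor** from the sandwich `(h′ − h)·2r(h) ≤ e(h) − e(h′)`: for `h₁ < h`,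
`(e(h₁) − e(h))/(2(h − h₁)) ≤ r(h)`. [cite: KomaTasaki1994, §1] -/
theorem chordFloor_le (hs : ∀ h h' : ℝ, (h' - h) * (2 * r h) ≤ e h - e h') {h₁ h : ℝ}
    (hlt : h₁ < h) : (e h₁ - e h) / (2 * (h - h₁)) ≤ r h := by
  rw [div_le_iff₀ (by linarith)]
  have := hs h h₁
  linarith

/-- **Chord ceiling** from the sandwich: for `h < h₂`, `r(h) ≤ (e(h) − e(h₂))/(2(h₂ − h))`.
[cite: KomaTasaki1994, §1] -/
theorem le_chordCeiling (hs : ∀ h h' : ℝ, (h' - h) * (2 * r h) ≤ e h - e h') {h h₂ : ℝ}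
    (hlt : h < h₂) : r h ≤ (e h - e h₂) / (2 * (h₂ - h)) := by
  rw [le_div_iff₀ (by linarith)]
  have := hs h h₂
  linarith

/-- The sandwich makes the response `r` non-decreasing. [cite: KomaTasaki1994, §1] -/
theorem monotone (hs : ∀ h h' : ℝ, (h' - h) * (2 * r h) ≤ e h - e h') : Monotone r := by
  intro h h' hle
  rcases eq_or_lt_of_le hle with rfl | hlt
  · exact le_rfl
  have h1 := hs h h'
  have h2 := hs h' h
  nlinarith

/-- The sandwich makes the energy `e` concave on `ℝ` (a supergradient inequality at every point).
[cite: KomaTasaki1994, §1] -/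
theorem concaveOn_univ (hs : ∀ h h' : ℝ, (h' - h) * (2 * r h) ≤ e h - e h') :
    ConcaveOn ℝ Set.univ e := by
  refine ⟨convex_univ, fun x _ y _ p q hp hq hpq => ?_⟩
  simp only [smul_eq_mul]
  have hq' : q = 1 - p := by linarith
  subst hq'
  have hx := mul_le_mul_of_nonneg_left (hs (p * x + (1 - p) * y) x) hp
  have hy := mul_le_mul_of_nonneg_left (hs (p * x + (1 - p) * y) y) hq
  linarith

/-- The sandwich with `|r| ≤ B` makes `e` `2B`-Lipschitz: `|e(h) − e(h′)| ≤ 2B|h − h′|` (the ground-state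
energy is `‖O‖`-Lipschitz in the source; Israel's Thm. I.3.4 is the pressure version). [cite: Israel1979, Thm. I.3.4] -/
theorem abs_sub_le (hs : ∀ h h' : ℝ, (h' - h) * (2 * r h) ≤ e h - e h')
    (hB : ∀ h : ℝ, |r h| ≤ B) (h h' : ℝ) : |e h - e h'| ≤ 2 * B * |h - h'| := by
  have h1 := hs h h'
  have h2 := hs h' h
  have hb := abs_le.1 (hB h)
  have hb' := abs_le.1 (hB h')
  rw [abs_le]
  rcases le_total h h' with hle | hle
  · rw [abs_of_nonpos (sub_nonpos.2 hle)]; constructor <;> nlinarith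
  · rw [abs_of_nonneg (sub_nonneg.2 hle)]; constructor <;> nlinarith

end OneVolume

/-! ### §2 Thermodynamic limit: brackets, Griffiths' lemma, the cusp identity -/

section Limit

variable {E m : ℕ → ℝ → ℝ} {g : ℝ → ℝ} {B : ℝ}

/-- `|m_L(h)| ≤ B` ⇒ the sequence `L ↦ m_L(h)` is bounded above … [folklore] -/
private theorem isBoundedUnder_le_of_abs_le (hB : ∀ (L : ℕ) (h : ℝ), |m L h| ≤ B) (h : ℝ) :
    IsBoundedUnder (· ≤ ·) atTop (fun L => m L h) := isBoundedUnder_of ⟨B, fun L => (abs_le.1 (hB L h)).2⟩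

/-- … and below. [folklore] -/
private theorem isBoundedUnder_ge_of_abs_le (hB : ∀ (L : ℕ) (h : ℝ), |m L h| ≤ B) (h : ℝ) :
    IsBoundedUnder (· ≥ ·) atTop (fun L => m L h) := isBoundedUnder_of ⟨-B, fun L => (abs_le.1 (hB L h)).1⟩

/-- **Limit floor**: with pointwise limits `E_L(h₁) → g(h₁)`, `E_L(h) → g(h)` (`h₁ < h`),
`(g(h₁) − g(h))/(2(h − h₁)) ≤ liminf_L m_L(h)`. [cite: KomaTasaki1994, §1] -/
theorem slope_le_liminf (hs : ∀ (L : ℕ) (h h' : ℝ), (h' - h) * (2 * m L h) ≤ E L h - E L h')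
    (hB : ∀ (L : ℕ) (h : ℝ), |m L h| ≤ B) {h₁ h : ℝ} (hlt : h₁ < h)
    (hg₁ : Tendsto (fun L => E L h₁) atTop (𝓝 (g h₁))) (hgh : Tendsto (fun L => E L h) atTop (𝓝 (g h))) :
    (g h₁ - g h) / (2 * (h - h₁)) ≤ liminf (fun L => m L h) atTop := by
  have hc : Tendsto (fun L => (E L h₁ - E L h) / (2 * (h - h₁))) atTop
      (𝓝 ((g h₁ - g h) / (2 * (h - h₁)))) := (hg₁.sub hgh).div_const _
  rw [← hc.liminf_eq]
  exact liminf_le_liminf (Eventually.of_forall fun L => chordFloor_le (hs L) hlt)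
    hc.isBoundedUnder_ge (isBoundedUnder_le_of_abs_le hB h).isCoboundedUnder_ge

/-- **Limit ceiling**: with pointwise limits `E_L(h) → g(h)`, `E_L(h₂) → g(h₂)` (`h < h₂`),
`limsup_L m_L(h) ≤ (g(h) − g(h₂))/(2(h₂ − h))`. [cite: KomaTasaki1994, §1] -/
theorem limsup_le_slope (hs : ∀ (L : ℕ) (h h' : ℝ), (h' - h) * (2 * m L h) ≤ E L h - E L h')
    (hB : ∀ (L : ℕ) (h : ℝ), |m L h| ≤ B) {h h₂ : ℝ} (hlt : h < h₂)
    (hgh : Tendsto (fun L => E L h) atTop (𝓝 (g h))) (hg₂ : Tendsto (fun L => E L h₂) atTop (𝓝 (g h₂))) :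
    limsup (fun L => m L h) atTop ≤ (g h - g h₂) / (2 * (h₂ - h)) := by
  have hc : Tendsto (fun L => (E L h - E L h₂) / (2 * (h₂ - h))) atTop
      (𝓝 ((g h - g h₂) / (2 * (h₂ - h)))) := (hgh.sub hg₂).div_const _
  rw [← hc.limsup_eq]
  exact limsup_le_limsup (Eventually.of_forall fun L => le_chordCeiling (hs L) hlt)
    (isBoundedUnder_ge_of_abs_le hB h).isCoboundedUnder_le hc.isBoundedUnder_le

/-- **Griffiths' lemma, left half**: a LEFT derivative `g′₋(h)` of the limit energy (limits existing at
all `h₁ < h` close to `h` and at `h`) bounds the response from below, `−g′₋(h)/2 ≤ liminf_L m_L(h)`.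
[cite: Griffiths1966, §II] -/
theorem neg_half_deriv_le_liminf
    (hs : ∀ (L : ℕ) (h h' : ℝ), (h' - h) * (2 * m L h) ≤ E L h - E L h')
    (hB : ∀ (L : ℕ) (h : ℝ), |m L h| ≤ B) {h g' : ℝ}
    (hg : ∀ᶠ h₁ in 𝓝[<] h, Tendsto (fun L => E L h₁) atTop (𝓝 (g h₁)))
    (hgh : Tendsto (fun L => E L h) atTop (𝓝 (g h))) (hd : HasDerivWithinAt g g' (Set.Iio h) h) :
    -g' / 2 ≤ liminf (fun L => m L h) atTop := by
  have hsl : Tendsto (slope g h) (𝓝[<] h) (𝓝 g') :=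
    (hasDerivWithinAt_iff_tendsto_slope' (by simp)).1 hd
  have hT : Tendsto (fun h₁ => -slope g h h₁ / 2) (𝓝[<] h) (𝓝 (-g' / 2)) := hsl.neg.div_const 2
  refine le_of_tendsto hT ?_
  filter_upwards [hg, self_mem_nhdsWithin] with h₁ hg₁ hh₁
  have hh₁' : h₁ < h := hh₁
  have key := slope_le_liminf hs hB hh₁' hg₁ hgh
  have hne : h₁ - h ≠ 0 := sub_ne_zero.2 hh₁'.ne
  have hne' : h - h₁ ≠ 0 := sub_ne_zero.2 hh₁'.ne'
  have e1 : -slope g h h₁ / 2 = (g h₁ - g h) / (2 * (h - h₁)) := by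
    rw [slope_def_field]
    field_simp
    ring
  rwa [e1]

/-- **Griffiths' lemma, right half**: a RIGHT derivative `g′₊(h)` of the limit energy (limits existing at
all `h₂ > h` close to `h` and at `h`) bounds the response from above, `limsup_L m_L(h) ≤ −g′₊(h)/2`.
[cite: Griffiths1966, §II] -/
theorem limsup_le_neg_half_deriv
    (hs : ∀ (L : ℕ) (h h' : ℝ), (h' - h) * (2 * m L h) ≤ E L h - E L h')
    (hB : ∀ (L : ℕ) (h : ℝ), |m L h| ≤ B) {h g' : ℝ}
    (hg : ∀ᶠ h₂ in 𝓝[>] h, Tendsto (fun L => E L h₂) atTop (𝓝 (g h₂)))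
    (hgh : Tendsto (fun L => E L h) atTop (𝓝 (g h))) (hd : HasDerivWithinAt g g' (Set.Ioi h) h) :
    limsup (fun L => m L h) atTop ≤ -g' / 2 := by
  have hsl : Tendsto (slope g h) (𝓝[>] h) (𝓝 g') :=
    (hasDerivWithinAt_iff_tendsto_slope' (by simp)).1 hd
  have hT : Tendsto (fun h₂ => -slope g h h₂ / 2) (𝓝[>] h) (𝓝 (-g' / 2)) := hsl.neg.div_const 2
  refine ge_of_tendsto hT ?_
  filter_upwards [hg, self_mem_nhdsWithin] with h₂ hg₂ hh₂
  have hh₂' : h < h₂ := hh₂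
  have key := limsup_le_slope hs hB hh₂' hgh hg₂
  have hne : h₂ - h ≠ 0 := sub_ne_zero.2 hh₂'.ne'
  have e1 : -slope g h h₂ / 2 = (g h - g h₂) / (2 * (h₂ - h)) := by
    rw [slope_def_field]
    field_simp
    ring
  rwa [e1]

/-- **Griffiths' lemma**: if the limit energy has pointwise limits near `h` and is differentiable at `h`
with derivative `g′`, the responses converge: `m_L(h) → −g′/2`. [cite: Griffiths1966, §II] -/
theorem tendsto_of_hasDerivAt
    (hs : ∀ (L : ℕ) (h h' : ℝ), (h' - h) * (2 * m L h) ≤ E L h - E L h')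
    (hB : ∀ (L : ℕ) (h : ℝ), |m L h| ≤ B) {h g' : ℝ}
    (hg : ∀ᶠ h' in 𝓝 h, Tendsto (fun L => E L h') atTop (𝓝 (g h'))) (hd : HasDerivAt g g' h) :
    Tendsto (fun L => m L h) atTop (𝓝 (-g' / 2)) := by
  have hgh : Tendsto (fun L => E L h) atTop (𝓝 (g h)) := hg.self_of_nhds
  refine tendsto_of_le_liminf_of_limsup_le ?_ ?_ (isBoundedUnder_le_of_abs_le hB h)
    (isBoundedUnder_ge_of_abs_le hB h)
  · exact neg_half_deriv_le_liminf hs hB (hg.filter_mono nhdsWithin_le_nhds) hgh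
      hd.hasDerivWithinAt
  · exact limsup_le_neg_half_deriv hs hB (hg.filter_mono nhdsWithin_le_nhds) hgh
      hd.hasDerivWithinAt

/-! #### Limits on `[0, ∞)`: concavity, Lipschitz continuity, and the cusp at `h = 0` -/

/-- The limit energy is concave on `[0, ∞)` (pointwise limit of concave functions).
[cite: KomaTasaki1994, §1] -/
theorem concaveOn_Ici
    (hs : ∀ (L : ℕ) (h h' : ℝ), (h' - h) * (2 * m L h) ≤ E L h - E L h')
    (hg : ∀ h : ℝ, 0 ≤ h → Tendsto (fun L => E L h) atTop (𝓝 (g h))) :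
    ConcaveOn ℝ (Set.Ici 0) g := by
  refine ⟨convex_Ici 0, fun x hx y hy p q hp hq hpq => ?_⟩
  simp only [smul_eq_mul]
  have hx' : 0 ≤ x := hx
  have hy' : 0 ≤ y := hy
  have hz : 0 ≤ p * x + q * y := by positivity
  have hlim := ((hg x hx').const_mul p).add ((hg y hy').const_mul q)
  refine le_of_tendsto_of_tendsto' hlim (hg _ hz) fun L => ?_
  have := (concaveOn_univ (hs L)).2 (Set.mem_univ x) (Set.mem_univ y) hp hq hpq
  simpa only [smul_eq_mul] using this

/-- The limit energy is `2B`-Lipschitz: `|g(h) − g(h′)| ≤ 2B|h − h′|` wherever both limits exist.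
[cite: Israel1979, Thm. I.3.4] -/
theorem abs_sub_le_of_tendsto
    (hs : ∀ (L : ℕ) (h h' : ℝ), (h' - h) * (2 * m L h) ≤ E L h - E L h')
    (hB : ∀ (L : ℕ) (h : ℝ), |m L h| ≤ B) {h h' : ℝ}
    (hgh : Tendsto (fun L => E L h) atTop (𝓝 (g h))) (hgh' : Tendsto (fun L => E L h') atTop (𝓝 (g h'))) :
    |g h - g h'| ≤ 2 * B * |h - h'| :=
  le_of_tendsto (hgh.sub hgh').abs
    (Eventually.of_forall fun L => abs_sub_le (hs L) (hB L) h h')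

/-- Right-continuity of the limit energy at `0` (from the Lipschitz bound). [cite: Israel1979, Thm. I.3.4] -/
theorem tendsto_nhdsGT_zero
    (hs : ∀ (L : ℕ) (h h' : ℝ), (h' - h) * (2 * m L h) ≤ E L h - E L h')
    (hB : ∀ (L : ℕ) (h : ℝ), |m L h| ≤ B)
    (hg : ∀ h : ℝ, 0 ≤ h → Tendsto (fun L => E L h) atTop (𝓝 (g h))) :
    Tendsto g (𝓝[>] 0) (𝓝 (g 0)) := by
  rw [Metric.tendsto_nhdsWithin_nhds]
  intro ε hε
  refine ⟨ε / (2 * |B| + 1), by positivity, fun h hh hdist => ?_⟩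
  have hh' : 0 < h := hh
  rw [Real.dist_eq, sub_zero, abs_of_pos hh'] at hdist
  have key := abs_sub_le_of_tendsto hs hB (hg h hh'.le) (hg 0 le_rfl)
  rw [sub_zero, abs_of_pos hh'] at key
  rw [Real.dist_eq]
  calc |g h - g 0| ≤ 2 * B * h := key
    _ ≤ (2 * |B| + 1) * h := by nlinarith [le_abs_self B]
    _ < (2 * |B| + 1) * (ε / (2 * |B| + 1)) := by gcongr
    _ = ε := by field_simp

/-- The stairs `liminf_L m_L(h)`, `h > 0`, are bounded below (by `−B`). [folklore] -/
private theorem bddBelow_range_liminf (hB : ∀ (L : ℕ) (h : ℝ), |m L h| ≤ B) :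
    BddBelow (Set.range fun h : Set.Ioi (0 : ℝ) => liminf (fun L => m L h) atTop) := by
  refine ⟨-B, ?_⟩
  rintro _ ⟨h, rfl⟩
  exact le_liminf_of_le (isBoundedUnder_le_of_abs_le hB h).isCoboundedUnder_ge
    (Eventually.of_forall fun L => (neg_le_neg (hB L h)).trans (neg_abs_le _))

/-- The secants `(g(0) − g(h))/(2h)`, `h > 0`, are bounded below (by `−B`). [folklore] -/
private theorem bddBelow_range_slope
    (hs : ∀ (L : ℕ) (h h' : ℝ), (h' - h) * (2 * m L h) ≤ E L h - E L h')
    (hB : ∀ (L : ℕ) (h : ℝ), |m L h| ≤ B)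
    (hg : ∀ h : ℝ, 0 ≤ h → Tendsto (fun L => E L h) atTop (𝓝 (g h))) :
    BddBelow (Set.range fun h : Set.Ioi (0 : ℝ) => (g 0 - g h) / (2 * h)) := by
  refine ⟨-B, ?_⟩
  rintro _ ⟨h, rfl⟩
  have hh : (0 : ℝ) < h := h.2
  have key := abs_sub_le_of_tendsto hs hB (hg 0 le_rfl) (hg h hh.le)
  rw [zero_sub, abs_neg, abs_of_pos hh] at key
  rw [le_div_iff₀ (by positivity)]
  linarith [(abs_le.1 key).1]

/-- **The cusp identity, infimum form**: with the sandwich, `|m_L| ≤ B` and pointwise limits on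
`[0,∞)`, `⨅_{h>0} liminf_L m_L(h) = ⨅_{h>0} (g(0) − g(h))/(2h)`. (`≥`: the limit floor with `h₁ = 0`;
`≤`: the limit ceiling `limsup_L m_L(h) ≤ (g(h) − g(h₂))/(2(h₂ − h))` and `h → 0⁺` by right-continuity
of `g`.) [cite: KomaTasaki1994, §1] -/
theorem iInf_liminf_eq_iInf_slope
    (hs : ∀ (L : ℕ) (h h' : ℝ), (h' - h) * (2 * m L h) ≤ E L h - E L h')
    (hB : ∀ (L : ℕ) (h : ℝ), |m L h| ≤ B)
    (hg : ∀ h : ℝ, 0 ≤ h → Tendsto (fun L => E L h) atTop (𝓝 (g h))) :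
    ⨅ h : Set.Ioi (0 : ℝ), liminf (fun L => m L h) atTop =
      ⨅ h : Set.Ioi (0 : ℝ), (g 0 - g h) / (2 * h) := by
  haveI : Nonempty (Set.Ioi (0 : ℝ)) := ⟨⟨1, Set.mem_Ioi.2 one_pos⟩⟩
  refine le_antisymm (le_ciInf fun h₂ => ?_) (le_ciInf fun h => ?_)
  · -- `⨅ F ≤ D(h₂)`: let `h → 0⁺` in `⨅ F ≤ limsup_L m_L(h) ≤ (g h − g h₂)/(2(h₂ − h))`
    have hh₂ : (0 : ℝ) < h₂ := h₂.2
    have hcont := tendsto_nhdsGT_zero hs hB hg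
    have hden : Tendsto (fun h : ℝ => 2 * (h₂ - h)) (𝓝[>] 0) (𝓝 (2 * (h₂ - 0))) :=
      ((tendsto_const_nhds.sub tendsto_id).const_mul 2).mono_left nhdsWithin_le_nhds
    have hT : Tendsto (fun h : ℝ => (g h - g h₂) / (2 * (h₂ - h))) (𝓝[>] 0)
        (𝓝 ((g 0 - g h₂) / (2 * (h₂ - 0)))) :=
      (hcont.sub tendsto_const_nhds).div hden (by rw [sub_zero]; positivity)
    rw [sub_zero] at hT
    refine ge_of_tendsto hT ?_
    filter_upwards [Ioo_mem_nhdsGT hh₂] with h hh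
    calc ⨅ h' : Set.Ioi (0 : ℝ), liminf (fun L => m L h') atTop
        ≤ liminf (fun L => m L h) atTop := ciInf_le (bddBelow_range_liminf hB) ⟨h, hh.1⟩
      _ ≤ limsup (fun L => m L h) atTop :=
          liminf_le_limsup (isBoundedUnder_le_of_abs_le hB h) (isBoundedUnder_ge_of_abs_le hB h)
      _ ≤ (g h - g h₂) / (2 * (h₂ - h)) :=
          limsup_le_slope hs hB hh.2 (hg h hh.1.le) (hg h₂ hh₂.le)
  · -- `⨅ D ≤ F(h)`: `D(h) ≤ F(h)` is the limit floor with `h₁ = 0`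
    have hh : (0 : ℝ) < h := h.2
    refine (ciInf_le (bddBelow_range_slope hs hB hg) h).trans ?_
    have key := slope_le_liminf hs hB hh (hg 0 le_rfl) (hg h hh.le)
    rwa [sub_zero] at key

/-- The secant `h ↦ (g(0) − g(h))/(2h)` is non-decreasing on `h > 0` (concavity of `g` on `[0,∞)`).
[cite: KomaTasaki1994, §1] -/
theorem monotoneOn_slope_of_concaveOn (hc : ConcaveOn ℝ (Set.Ici 0) g) :
    MonotoneOn (fun h : ℝ => (g 0 - g h) / (2 * h)) (Set.Ioi 0) := by
  intro h hh h' hh' hle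
  have hh0 : (0 : ℝ) < h := hh
  have hh0' : (0 : ℝ) < h' := hh'
  have key := hc.neg.secant_mono (a := 0) (x := h) (y := h') (Set.mem_Ici.2 le_rfl)
    (Set.mem_Ici.2 hh0.le) (Set.mem_Ici.2 hh0'.le) hh0.ne' hh0'.ne' hle
  simp only [Pi.neg_apply, sub_zero] at key
  have e1 : (g 0 - g h) / (2 * h) = (-g h - -g 0) / h / 2 := by ring
  have e2 : (g 0 - g h') / (2 * h') = (-g h' - -g 0) / h' / 2 := by ring
  simp only [e1, e2]
  exact div_le_div_of_nonneg_right key zero_le_two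

/-- **The cusp identity, limit form**: `(g(0) − g(h))/(2h) → ⨅_{h>0} liminf_L m_L(h)` as `h → 0⁺`
(a monotone secant converges to its infimum). [cite: KomaTasaki1994, §1] -/
theorem tendsto_slope_nhdsGT
    (hs : ∀ (L : ℕ) (h h' : ℝ), (h' - h) * (2 * m L h) ≤ E L h - E L h')
    (hB : ∀ (L : ℕ) (h : ℝ), |m L h| ≤ B)
    (hg : ∀ h : ℝ, 0 ≤ h → Tendsto (fun L => E L h) atTop (𝓝 (g h))) :
    Tendsto (fun h : ℝ => (g 0 - g h) / (2 * h)) (𝓝[>] 0)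
      (𝓝 (⨅ h : Set.Ioi (0 : ℝ), liminf (fun L => m L h) atTop)) := by
  have hmono := monotoneOn_slope_of_concaveOn (concaveOn_Ici hs hg)
  have hbdd : BddBelow ((fun h : ℝ => (g 0 - g h) / (2 * h)) '' Set.Ioi 0) := by
    rw [Set.image_eq_range]
    exact bddBelow_range_slope hs hB hg
  have key := hmono.tendsto_nhdsGT hbdd
  rwa [sInf_image', ← iInf_liminf_eq_iInf_slope hs hB hg] at key

/-- **The cusp identity, derivative form**: if `g` has a RIGHT derivative `g′₊(0)` at `0`, then
`⨅_{h>0} liminf_L m_L(h) = −g′₊(0)/2`. [cite: Griffiths1966, §II] -/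
theorem iInf_liminf_eq_neg_half_deriv
    (hs : ∀ (L : ℕ) (h h' : ℝ), (h' - h) * (2 * m L h) ≤ E L h - E L h')
    (hB : ∀ (L : ℕ) (h : ℝ), |m L h| ≤ B)
    (hg : ∀ h : ℝ, 0 ≤ h → Tendsto (fun L => E L h) atTop (𝓝 (g h))) {g' : ℝ}
    (hd : HasDerivWithinAt g g' (Set.Ioi 0) 0) :
    ⨅ h : Set.Ioi (0 : ℝ), liminf (fun L => m L h) atTop = -g' / 2 := by
  have hsl : Tendsto (slope g 0) (𝓝[>] 0) (𝓝 g') :=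
    (hasDerivWithinAt_iff_tendsto_slope' (by simp)).1 hd
  have hT : Tendsto (fun h => -slope g 0 h / 2) (𝓝[>] 0) (𝓝 (-g' / 2)) := hsl.neg.div_const 2
  have hT' : Tendsto (fun h : ℝ => (g 0 - g h) / (2 * h)) (𝓝[>] 0) (𝓝 (-g' / 2)) := by
    refine hT.congr' ?_
    filter_upwards [self_mem_nhdsWithin] with h hh
    have hh' : (0 : ℝ) < h := hh
    rw [slope_def_field, sub_zero]
    field_simp
    ring
  exact tendsto_nhds_unique (tendsto_slope_nhdsGT hs hB hg) hT'

/-- **Order = linear cusp**: `0 < ⨅_{h>0} liminf_L m_L(h)` iff the limit energy drops LINEARLY at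
`0⁺`, `∃ c > 0, ∀ h > 0, g(h) ≤ g(0) − 2ch`. [cite: KomaTasaki1994, §1] -/
theorem iInf_liminf_pos_iff_linear_cusp
    (hs : ∀ (L : ℕ) (h h' : ℝ), (h' - h) * (2 * m L h) ≤ E L h - E L h')
    (hB : ∀ (L : ℕ) (h : ℝ), |m L h| ≤ B)
    (hg : ∀ h : ℝ, 0 ≤ h → Tendsto (fun L => E L h) atTop (𝓝 (g h))) :
    0 < ⨅ h : Set.Ioi (0 : ℝ), liminf (fun L => m L h) atTop ↔
      ∃ c : ℝ, 0 < c ∧ ∀ h : ℝ, 0 < h → g h ≤ g 0 - 2 * c * h := by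
  haveI : Nonempty (Set.Ioi (0 : ℝ)) := ⟨⟨1, Set.mem_Ioi.2 one_pos⟩⟩
  rw [iInf_liminf_eq_iInf_slope hs hB hg]
  constructor
  · intro hpos
    refine ⟨_, hpos, fun h hh => ?_⟩
    have key := ciInf_le (bddBelow_range_slope hs hB hg) ⟨h, hh⟩
    dsimp only at key
    rw [le_div_iff₀ (by positivity)] at key
    linarith
  · rintro ⟨c, hc, H⟩
    refine lt_of_lt_of_le hc (le_ciInf fun h => ?_)
    have hh : (0 : ℝ) < h := h.2
    rw [le_div_iff₀ (by positivity)]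
    linarith [H h hh]

end Limit

end SourceSandwich

end Literature.MathematicalPhysics.QuantumLattice

end
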